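import Mathlib.Data.List.FinRange
import Mathlib.Data.List.OfFn
import Mathlib.Data.Fintype.Option
import Mathlib.Data.Fintype.Prod
import Mathlib.Tactic.DeriveFintype
import Mathlib.Tactic.Linarith
import Mathlib.Tactic.Ring
import Literature.Computability.Complexity.DeMorganSimulation
import HarnessLib

/-!
# A polynomial-size De Morgan circuit for bipartite perfect matching — the construction

The perfect matching function `f_m` of the `m²` edge variables of `K_{m,m}` (the logical
permanent; `Literature.Barriers.PneNP.perfectMatchingFn`) is computable in polynomial time
(Kuhn 1955; Hopcroft–Karp 1973, `O(m^{5/2})`), "hence, `f_m` can be computed by a non-monotone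
circuit using only `O(m⁵)` gates" (Jukna 2012, §9.11, PDF p. 291) — the upper-bound half of
Razborov's monotone/non-monotone gap for the logical permanent (named fact
`Literature.Barriers.PneNP.perfectMatching_polysize`). This file and
`PerfectMatchingCircuitCorrect.lean` PROVE the polynomial upper bound by realising the
augmenting-path algorithm (Korte–Vygen 2018, Thm. 10.5 with Berge's Thm. 10.7 and Hall's
Thm. 10.3/10.4) DIRECTLY as a straight-line program over `{∧₂, ∨₂, ¬}` in the `CktSize`
calculus of `CircuitComposition.lean`, layer by layer, each layer being a family of De Morgan
formulas (`DMF`, `DeMorganSimulation.lean`) over the previous state vector.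

**The state vector** (`BipMatch.St m`): the input edges `x v w`, the current matching
`mt v w`, the alternating-BFS data `s v`, `t w` (reached left/right vertices) and `p v w`
(the BFS parent edge of a right vertex: its least reached neighbour at the moment it is
reached), the selected free right vertex `wsel w` and success bit `ok`, and the vertex sets
`pl v`, `pr w` of the augmenting path.

**The layers** (`…φ` = formulas, `…St` = the map on state vectors): `initSt` (load `x`,
empty matching); for each root `u < m` one PHASE `phaseSt u =` `resetSt u` (`S = {u}`,
`T = P = ∅`) ; `bfsSt^[2m]` (`T' = T ∪ N(S)`, parents for new right vertices,
`S' = S ∪ mates(T')`) ; `chooseSt` (`wsel` = least reached unmatched right vertex, `ok`) ;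
`pathSt^[2m]` (`PR' = PR ∪ {wsel} ∪ mates(PL)`, `PL' = PL ∪ parents(PR')`) ; `augmentSt`
(if `ok`, the new matching is the set of parent edges into `PR` together with the old matching
edges off the path; otherwise the matching is kept); finally `outSt` (every left vertex is
matched). `pmFn x = outSt (phasesSt m (initSt x))`.

**Proved here**: the semantics of every layer (`bfsSt_t`, `bfsSt_p`, …), frame lemmas, the
formula-size bounds (`fBound m = 10 (m+1)²` per formula, `layerBound`, `phaseBound`), and
`cktSize_pmFn : CktSize deMorganBasis pmFn (totalBound m)` with
`totalBound m ≤ 600 (m+1)⁶` (`totalBound_le`); plus the generic tools `DMF.bigOr/bigAnd`,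
`cktSize_formulaLayer` and the stabilisation lemma `iterate_fixed_of_potential` for
inflationary iterations. Correctness (`pmFn x () = true ↔` perfect matching) is
`BipMatch.pmFn_eq_true_iff` in `PerfectMatchingCircuitCorrect.lean`; the discharge
`perfectMatching_polysize_holds` is in `Literature/Barriers/PneNP/MonotoneGapMatchingProofs.lean`.

Design notes: no sharing inside a layer is attempted (every output coordinate is its own
formula, `CktSize.pi_const`), which is why the bound is `O(m⁶ )`-ish gates per the crude count
rather than Jukna's `O(m⁵)`; only polynomiality is claimed. Constants are the formulas
`ok ∧ ¬ok`, `ok ∨ ¬ok` on the always-present coordinate `ok` (and on an input variable `e₀`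
in the input layer, whence `m ≥ 1` there).

## References

* [Jukna2012] S. Jukna, *Boolean Function Complexity* (2012), §9.11 (PDF p. 291): `f_m`,
  Hopcroft–Karp, "non-monotone circuit using only `O(m⁵)` gates".
* [HopcroftKarp1973] J. E. Hopcroft, R. M. Karp, *An `n^{5/2}` algorithm for maximum matchings
  in bipartite graphs*, SIAM J. Comput. 2 (1973) 225–231 (text not held; WANTED filed).
* [KorteVygen2018] B. Korte, J. Vygen, *Combinatorial Optimization* (6th ed., 2018), §10.1:
  Thm. 10.3 (Hall), Thm. 10.4 (Frobenius), Thm. 10.5 (bipartite cardinality matching by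
  augmenting paths, "essentially due to Kuhn [1955]"), Def. 10.6 and Thm. 10.7 (Berge) —
  PDF pp. 238–240 (held).
-/

namespace Literature.Computability.Complexity

open GateList

/-! ### De Morgan formula helpers: big disjunctions / conjunctions, formula layers -/

namespace DMF

variable {J : Type*}

/-- A variable evaluates to its value. [folklore] -/
@[simp] theorem eval_var (j : J) (y : J → Bool) : (var j).eval y = y j := rfl
/-- Negation evaluates to `!`. [folklore] -/
@[simp] theorem eval_neg (φ : DMF J) (y : J → Bool) : (neg φ).eval y = !φ.eval y := rfl
/-- Conjunction evaluates to `&&`. [folklore] -/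
@[simp] theorem eval_conj (φ ψ : DMF J) (y : J → Bool) :
    (conj φ ψ).eval y = (φ.eval y && ψ.eval y) := rfl
/-- Disjunction evaluates to `||`. [folklore] -/
@[simp] theorem eval_disj (φ ψ : DMF J) (y : J → Bool) :
    (disj φ ψ).eval y = (φ.eval y || ψ.eval y) := rfl
/-- A variable has no connectives. [folklore] -/
@[simp] theorem size_var (j : J) : (var j : DMF J).size = 0 := rfl
/-- Size of a negation. [folklore] -/
@[simp] theorem size_neg (φ : DMF J) : (neg φ).size = φ.size + 1 := rfl
/-- Size of a conjunction. [folklore] -/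
@[simp] theorem size_conj (φ ψ : DMF J) : (conj φ ψ).size = φ.size + ψ.size + 1 := rfl
/-- Size of a disjunction. [folklore] -/
@[simp] theorem size_disj (φ ψ : DMF J) : (disj φ ψ).size = φ.size + ψ.size + 1 := rfl
/-- The constant-true formula has two connectives. [folklore] -/
@[simp] theorem size_tt (j : J) : (tt j).size = 2 := rfl
/-- The constant-false formula has two connectives. [folklore] -/
@[simp] theorem size_ff (j : J) : (ff j).size = 2 := rfl

/-- Big disjunction of a list of formulas (the empty disjunction is the constant-false formula
on the variable `j₀`). [folklore] -/
def bigOr (j₀ : J) : List (DMF J) → DMF J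
  | [] => ff j₀
  | φ :: l => disj φ (bigOr j₀ l)

/-- Big conjunction of a list of formulas (the empty conjunction is the constant-true formula
on the variable `j₀`). [folklore] -/
def bigAnd (j₀ : J) : List (DMF J) → DMF J
  | [] => tt j₀
  | φ :: l => conj φ (bigAnd j₀ l)

/-- A big disjunction is true iff some disjunct is. [folklore] -/
theorem eval_bigOr (j₀ : J) (l : List (DMF J)) (y : J → Bool) :
    (bigOr j₀ l).eval y = true ↔ ∃ φ ∈ l, φ.eval y = true := by
  induction l with
  | nil => simp [bigOr]
  | cons φ l ih => simp [bigOr, ih]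

/-- A big conjunction is true iff every conjunct is. [folklore] -/
theorem eval_bigAnd (j₀ : J) (l : List (DMF J)) (y : J → Bool) :
    (bigAnd j₀ l).eval y = true ↔ ∀ φ ∈ l, φ.eval y = true := by
  induction l with
  | nil => simp [bigAnd]
  | cons φ l ih => simp [bigAnd, ih]

/-- Size of a big disjunction of formulas of size `≤ c`. [folklore] -/
theorem size_bigOr_le (j₀ : J) {c : ℕ} :
    ∀ {l : List (DMF J)}, (∀ φ ∈ l, φ.size ≤ c) → (bigOr j₀ l).size ≤ 2 + l.length * (c + 1)
  | [], _ => by simp [bigOr]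
  | φ :: l, h => by
    have h1 : φ.size ≤ c := h φ (by simp)
    have h2 := size_bigOr_le j₀ (l := l) fun ψ hψ => h ψ (by simp [hψ])
    simp only [bigOr, size_disj, List.length_cons, Nat.succ_mul]
    omega

/-- Size of a big conjunction of formulas of size `≤ c`. [folklore] -/
theorem size_bigAnd_le (j₀ : J) {c : ℕ} :
    ∀ {l : List (DMF J)}, (∀ φ ∈ l, φ.size ≤ c) → (bigAnd j₀ l).size ≤ 2 + l.length * (c + 1)
  | [], _ => by simp [bigAnd]
  | φ :: l, h => by
    have h1 : φ.size ≤ c := h φ (by simp)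
    have h2 := size_bigAnd_le j₀ (l := l) fun ψ hψ => h ψ (by simp [hψ])
    simp only [bigAnd, size_conj, List.length_cons, Nat.succ_mul]
    omega

end DMF

/-- **Formula layers**: a multi-output map each of whose outputs is given by a De Morgan
formula of size `≤ c` over the inputs has a `{∧₂, ∨₂, ¬}`-program with `card κ * c` gates
(no sharing between the outputs is needed). [folklore] -/
theorem cktSize_formulaLayer {J κ : Type*} [Fintype κ] (φ : κ → DMF J) {c : ℕ}
    (hc : ∀ k, (φ k).size ≤ c) :
    CktSize deMorganBasis (fun (y : J → Bool) k => (φ k).eval y) (Fintype.card κ * c) :=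
  CktSize.pi_const fun k => (DMF.cktSize (φ k)).of_le (hc k)

/-! ### Stabilisation of inflationary iterations -/

/-- If `F` never decreases a bounded ℕ-valued potential `a`, and fixes every point whose
potential it does not raise, then `N` iterations from any start reach a fixed point, where `N`
bounds the potential. [folklore] -/
theorem iterate_fixed_of_potential {α : Type*} (F : α → α) (a : α → ℕ) (N : ℕ)
    (hmono : ∀ s, a s ≤ a (F s)) (hfix : ∀ s, a (F s) = a s → F s = s)
    (hbound : ∀ s, a s ≤ N) (s₀ : α) : F (F^[N] s₀) = F^[N] s₀ := by
  by_contra hN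
  have key : ∀ n, F (F^[n] s₀) ≠ F^[n] s₀ → a s₀ + n + 1 ≤ a (F^[n + 1] s₀) := by
    intro n
    induction n with
    | zero =>
      intro h0
      have h1 : a (F s₀) ≠ a s₀ := fun h => h0 (hfix s₀ h)
      have h2 := hmono s₀
      rw [Function.iterate_succ_apply', Function.iterate_zero_apply]
      omega
    | succ n ih =>
      intro hn1
      have hn : F (F^[n] s₀) ≠ F^[n] s₀ := by
        intro hfixn
        apply hn1
        rw [Function.iterate_succ_apply', hfixn, hfixn]
      have h1 := ih hn
      have h2 : a (F (F^[n + 1] s₀)) ≠ a (F^[n + 1] s₀) := fun h => hn1 (hfix _ h)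
      have h3 := hmono (F^[n + 1] s₀)
      rw [Function.iterate_succ_apply' F (n + 1)]
      omega
  have := key N hN
  have hb := hbound (F^[N + 1] s₀)
  omega

namespace BipMatch

/-! ### The state vector -/

/-- Index type of the state vector of the matching circuit on `K_{m,m}`: input edges `x v w`,
current matching `mt v w`, alternating-BFS data `s v` (reached left vertices), `t w` (reached
right vertices), `p v w` (BFS parent edges), the selected free right vertex `wsel w`, the success
bit `ok`, and the augmenting-path vertex sets `pl v`, `pr w`. [folklore] -/
inductive St (m : ℕ) : Type
  | x (v w : Fin m)
  | mt (v w : Fin m)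
  | s (v : Fin m)
  | t (w : Fin m)
  | p (v w : Fin m)
  | wsel (w : Fin m)
  | ok
  | pl (v : Fin m)
  | pr (w : Fin m)
  deriving DecidableEq, Fintype

variable {m : ℕ}

/-- An injective coding of state indices into `Fin 9 × Option (Fin m) × Option (Fin m)` (to
bound their number). [folklore] -/
def St.code : St m → Fin 9 × Option (Fin m) × Option (Fin m)
  | .x v w => (0, some v, some w)
  | .mt v w => (1, some v, some w)
  | .s v => (2, some v, none)
  | .t w => (3, some w, none)
  | .p v w => (4, some v, some w)
  | .wsel w => (5, some w, none)
  | .ok => (6, none, none)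
  | .pl v => (7, some v, none)
  | .pr w => (8, some w, none)

/-- The coding of state indices is injective. [folklore] -/
theorem St.code_injective : Function.Injective (St.code (m := m)) := by
  intro a b h
  cases a <;> cases b <;> simp_all [St.code]

/-- There are at most `9 (m+1)²` state indices. [folklore] -/
theorem card_St_le : Fintype.card (St m) ≤ 9 * (m + 1) ^ 2 := by
  have := Fintype.card_le_of_injective _ (St.code_injective (m := m))
  simpa [Fintype.card_prod, Fintype.card_option, pow_two, mul_assoc] using this

/-! ### Formula combinators over the state variables -/

/-- The constant-false formula (on the always-present variable `ok`). [folklore] -/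
def ffm : DMF (St m) := DMF.ff .ok

/-- The constant-true formula. [folklore] -/
def ttm : DMF (St m) := DMF.tt .ok

/-- `⋁_{i < m} φ i`. [folklore] -/
def orFin (φ : Fin m → DMF (St m)) : DMF (St m) := DMF.bigOr .ok (List.ofFn φ)

/-- `⋀_{i < m} φ i`. [folklore] -/
def andFin (φ : Fin m → DMF (St m)) : DMF (St m) := DMF.bigAnd .ok (List.ofFn φ)

/-- `⋀_{i < w} φ i` (conjunction over the indices below `w` only). [folklore] -/
def andLt (w : Fin m) (φ : Fin m → DMF (St m)) : DMF (St m) :=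
  DMF.bigAnd .ok (((List.finRange m).filter fun i => i < w).map φ)

/-- The constant-false formula evaluates to `false`. [folklore] -/
@[simp] theorem eval_ffm (y : St m → Bool) : (ffm : DMF (St m)).eval y = false := DMF.eval_ff _ _
/-- The constant-true formula evaluates to `true`. [folklore] -/
@[simp] theorem eval_ttm (y : St m → Bool) : (ttm : DMF (St m)).eval y = true := DMF.eval_tt _ _

/-- Semantics of `orFin`. [folklore] -/
theorem eval_orFin (φ : Fin m → DMF (St m)) (y : St m → Bool) :
    (orFin φ).eval y = true ↔ ∃ i, (φ i).eval y = true := by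
  simp [orFin, DMF.eval_bigOr, List.mem_ofFn]

/-- Semantics of `andFin`. [folklore] -/
theorem eval_andFin (φ : Fin m → DMF (St m)) (y : St m → Bool) :
    (andFin φ).eval y = true ↔ ∀ i, (φ i).eval y = true := by
  simp [andFin, DMF.eval_bigAnd, List.mem_ofFn]

/-- Semantics of `andLt`. [folklore] -/
theorem eval_andLt (w : Fin m) (φ : Fin m → DMF (St m)) (y : St m → Bool) :
    (andLt w φ).eval y = true ↔ ∀ i, i < w → (φ i).eval y = true := by
  simp [andLt, DMF.eval_bigAnd, List.mem_filter, List.mem_finRange]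

/-- Size of `orFin` over formulas of size `≤ c`. [folklore] -/
theorem size_orFin_le (φ : Fin m → DMF (St m)) {c : ℕ} (h : ∀ i, (φ i).size ≤ c) :
    (orFin φ).size ≤ 2 + m * (c + 1) := by
  have := DMF.size_bigOr_le (St.ok (m := m)) (l := List.ofFn φ) (c := c)
    (by intro ψ hψ; obtain ⟨i, rfl⟩ := List.mem_ofFn.1 hψ; exact h i)
  simpa [orFin] using this

/-- Size of `andFin` over formulas of size `≤ c`. [folklore] -/
theorem size_andFin_le (φ : Fin m → DMF (St m)) {c : ℕ} (h : ∀ i, (φ i).size ≤ c) :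
    (andFin φ).size ≤ 2 + m * (c + 1) := by
  have := DMF.size_bigAnd_le (St.ok (m := m)) (l := List.ofFn φ) (c := c)
    (by intro ψ hψ; obtain ⟨i, rfl⟩ := List.mem_ofFn.1 hψ; exact h i)
  simpa [andFin] using this

/-- Size of `andLt` over formulas of size `≤ c`. [folklore] -/
theorem size_andLt_le (w : Fin m) (φ : Fin m → DMF (St m)) {c : ℕ} (h : ∀ i, (φ i).size ≤ c) :
    (andLt w φ).size ≤ 2 + m * (c + 1) := by
  have hl : (((List.finRange m).filter fun i => i < w).map φ).length ≤ m := by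
    simpa using (List.length_filter_le _ (List.finRange m)).trans (by simp)
  have := DMF.size_bigAnd_le (St.ok (m := m))
    (l := ((List.finRange m).filter fun i => i < w).map φ) (c := c)
    (by intro ψ hψ; obtain ⟨i, -, rfl⟩ := List.mem_map.1 hψ; exact h i)
  simp only [andLt]
  exact this.trans (by nlinarith)


/-! ### The layers of one phase, as formulas and as maps on state vectors -/

open DMF in
/-- `T' w = T w ∨ ⋁_v (S v ∧ x v w)`: the right vertices reached after one more BFS round. [folklore] -/
def tφ (w : Fin m) : DMF (St m) :=
  disj (var (.t w)) (orFin fun v => conj (var (.s v)) (var (.x v w)))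

open DMF in
/-- One round of the alternating breadth-first search from the root, as formulas: `T' = T ∪ N(S)`;
a NEW right vertex `w` gets the parent edge `(v, w)` from its least neighbour `v ∈ S`;
`S' = S ∪ mates(T')`. All other coordinates are passed through. [folklore] -/
def bfsφ : St m → DMF (St m)
  | .t w => tφ w
  | .p v w => disj (var (.p v w)) (conj (neg (var (.t w))) (conj (var (.s v)) (conj (var (.x v w))
      (andLt v fun v' => neg (conj (var (.s v')) (var (.x v' w)))))))
  | .s v => disj (var (.s v)) (orFin fun w => conj (tφ w) (var (.mt v w)))
  | k => var k

/-- One BFS round on state vectors. [folklore] -/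
def bfsSt (y : St m → Bool) : St m → Bool := fun k => (bfsφ k).eval y

open DMF in
/-- Start of phase `u`: keep the input edges and the matching, set `S = {u}`, clear everything
else. [folklore] -/
def resetφ (u : Fin m) : St m → DMF (St m)
  | .x v w => var (.x v w)
  | .mt v w => var (.mt v w)
  | .s v => if v = u then ttm else ffm
  | _ => ffm

/-- Phase initialisation on state vectors. [folklore] -/
def resetSt (u : Fin m) (y : St m → Bool) : St m → Bool := fun k => (resetφ u k).eval y

open DMF in
/-- `free w = ¬ ⋁_v M v w`: the right vertex `w` is unmatched. [folklore] -/
def freeφ (w : Fin m) : DMF (St m) := neg (orFin fun v => var (.mt v w))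

open DMF in
/-- After the search: select the least reached free right vertex (`wsel`), record whether there
is one (`ok`), clear the path sets. [folklore] -/
def chooseφ : St m → DMF (St m)
  | .wsel w => conj (var (.t w)) (conj (freeφ w)
      (andLt w fun w' => neg (conj (var (.t w')) (freeφ w'))))
  | .ok => orFin fun w => conj (var (.t w)) (freeφ w)
  | .pl _ => ffm
  | .pr _ => ffm
  | k => var k

/-- The selection layer on state vectors. [folklore] -/
def chooseSt (y : St m → Bool) : St m → Bool := fun k => (chooseφ k).eval y

open DMF in
/-- `PR' w = PR w ∨ wsel w ∨ ⋁_v (PL v ∧ M v w)`: right vertices on the augmenting path. [folklore] -/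
def prφ (w : Fin m) : DMF (St m) :=
  disj (disj (var (.pr w)) (var (.wsel w))) (orFin fun v => conj (var (.pl v)) (var (.mt v w)))

open DMF in
/-- One round of tracing the augmenting path backwards: right vertices on the path are the
selected vertex and the mates of left path vertices; left path vertices are the BFS parents of
right path vertices. [folklore] -/
def pathφ : St m → DMF (St m)
  | .pr w => prφ w
  | .pl v => disj (var (.pl v)) (orFin fun w => conj (prφ w) (var (.p v w)))
  | k => var k

/-- One path-tracing round on state vectors. [folklore] -/
def pathSt (y : St m → Bool) : St m → Bool := fun k => (pathφ k).eval y

open DMF in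
/-- Augmentation: if `ok`, the new matching consists of the parent edges into right path
vertices together with the old matching edges avoiding the path; otherwise the matching is
kept. [folklore] -/
def augmentφ : St m → DMF (St m)
  | .mt v w => disj (conj (var .ok) (disj (conj (var (.pr w)) (var (.p v w)))
      (conj (var (.mt v w)) (conj (neg (var (.pl v))) (neg (var (.pr w)))))))
      (conj (neg (var .ok)) (var (.mt v w)))
  | k => var k

/-- The augmentation layer on state vectors. [folklore] -/
def augmentSt (y : St m → Bool) : St m → Bool := fun k => (augmentφ k).eval y

/-- One phase of the Hungarian-tree (Kuhn / Hopcroft–Karp augmenting path) algorithm for the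
root `u`: reset, `2m` BFS rounds, selection, `2m` path rounds, augmentation. [folklore] -/
def phaseSt (u : Fin m) (y : St m → Bool) : St m → Bool :=
  augmentSt (pathSt^[2 * m] (chooseSt (bfsSt^[2 * m] (resetSt u y))))

/-- The first `k` phases (roots `0, …, k-1`; nothing happens beyond `m`). [folklore] -/
def phasesSt : ℕ → (St m → Bool) → St m → Bool
  | 0 => id
  | k + 1 => fun y => if h : k < m then phaseSt ⟨k, h⟩ (phasesSt k y) else phasesSt k y

/-- Loading the input: edges from `x`, empty matching, everything else cleared. [folklore] -/
def initSt (x : Fin m × Fin m → Bool) : St m → Bool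
  | .x v w => x (v, w)
  | _ => false

/-- The output bit: every left vertex is matched. [folklore] -/
def outSt (y : St m → Bool) : Unit → Bool := fun _ => decide (∀ v, ∃ w, y (.mt v w) = true)

/-- The Boolean function computed by the matching circuit on `K_{m,m}`. [folklore] -/
def pmFn (x : Fin m × Fin m → Bool) : Unit → Bool := outSt (phasesSt m (initSt x))

/-! ### What the layers compute -/

section eval

variable (y : St m → Bool)

/-- Semantics of `tφ`: `T' = T ∪ N(S)`. [folklore] -/
theorem tφ_eval (w : Fin m) :
    (tφ w).eval y = true ↔ y (.t w) = true ∨ ∃ v, y (.s v) = true ∧ y (.x v w) = true := by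
  simp [tφ, eval_orFin]

/-- The BFS round on the `t` coordinates: `T' = T ∪ N(S)`. [folklore] -/
theorem bfsSt_t (w : Fin m) :
    bfsSt y (.t w) = true ↔ y (.t w) = true ∨ ∃ v, y (.s v) = true ∧ y (.x v w) = true := by
  simp [bfsSt, bfsφ, tφ_eval]

/-- The BFS round on the `p` coordinates: a new right vertex gets its least neighbour in `S` as parent. [folklore] -/
theorem bfsSt_p (v w : Fin m) :
    bfsSt y (.p v w) = true ↔ y (.p v w) = true ∨
      (y (.t w) = false ∧ y (.s v) = true ∧ y (.x v w) = true ∧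
        ∀ v', v' < v → (y (.s v') = false ∨ y (.x v' w) = false)) := by
  simp [bfsSt, bfsφ, eval_andLt]

/-- The BFS round on the `s` coordinates: `S' = S ∪ mates(T')`. [folklore] -/
theorem bfsSt_s (v : Fin m) :
    bfsSt y (.s v) = true ↔ y (.s v) = true ∨ ∃ w, bfsSt y (.t w) = true ∧ y (.mt v w) = true := by
  simp [bfsSt, bfsφ, eval_orFin, tφ_eval]

/-- The BFS layer passes the `x` coordinates through. [folklore] -/
@[simp] theorem bfsSt_x (v w : Fin m) : bfsSt y (.x v w) = y (.x v w) := rfl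
/-- The BFS layer passes the `mt` coordinates through. [folklore] -/
@[simp] theorem bfsSt_mt (v w : Fin m) : bfsSt y (.mt v w) = y (.mt v w) := rfl
/-- The BFS layer passes the `wsel` coordinates through. [folklore] -/
@[simp] theorem bfsSt_wsel (w : Fin m) : bfsSt y (.wsel w) = y (.wsel w) := rfl
/-- The BFS layer passes the `ok` coordinates through. [folklore] -/
@[simp] theorem bfsSt_ok : bfsSt y .ok = y .ok := rfl
/-- The BFS layer passes the `pl` coordinates through. [folklore] -/
@[simp] theorem bfsSt_pl (v : Fin m) : bfsSt y (.pl v) = y (.pl v) := rfl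
/-- The BFS layer passes the `pr` coordinates through. [folklore] -/
@[simp] theorem bfsSt_pr (w : Fin m) : bfsSt y (.pr w) = y (.pr w) := rfl

/-- The reset layer passes the `x` coordinates through. [folklore] -/
@[simp] theorem resetSt_x (u v w : Fin m) : resetSt u y (.x v w) = y (.x v w) := rfl
/-- The reset layer passes the `mt` coordinates through. [folklore] -/
@[simp] theorem resetSt_mt (u v w : Fin m) : resetSt u y (.mt v w) = y (.mt v w) := rfl
/-- The reset layer sets `S = {u}`. [folklore] -/
@[simp] theorem resetSt_s (u v : Fin m) : resetSt u y (.s v) = decide (v = u) := by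
  by_cases h : v = u <;> simp [resetSt, resetφ, h]
/-- The reset layer clears the `t` coordinates. [folklore] -/
@[simp] theorem resetSt_t (u w : Fin m) : resetSt u y (.t w) = false := by simp [resetSt, resetφ]
/-- The reset layer clears the `p` coordinates. [folklore] -/
@[simp] theorem resetSt_p (u v w : Fin m) : resetSt u y (.p v w) = false := by
  simp [resetSt, resetφ]
/-- The reset layer clears the `wsel` coordinates. [folklore] -/
@[simp] theorem resetSt_wsel (u w : Fin m) : resetSt u y (.wsel w) = false := by
  simp [resetSt, resetφ]
/-- The reset layer clears the `ok` coordinates. [folklore] -/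
@[simp] theorem resetSt_ok (u : Fin m) : resetSt u y .ok = false := by simp [resetSt, resetφ]
/-- The reset layer clears the `pl` coordinates. [folklore] -/
@[simp] theorem resetSt_pl (u v : Fin m) : resetSt u y (.pl v) = false := by simp [resetSt, resetφ]
/-- The reset layer clears the `pr` coordinates. [folklore] -/
@[simp] theorem resetSt_pr (u w : Fin m) : resetSt u y (.pr w) = false := by simp [resetSt, resetφ]

/-- `freeφ w` is false iff `w` is matched. [folklore] -/
theorem freeφ_eval_false (w : Fin m) : (freeφ w).eval y = false ↔ ∃ v, y (.mt v w) = true := by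
  have h := eval_orFin (fun v => (DMF.var (St.mt v w) : DMF (St m))) y
  simp only [DMF.eval_var] at h
  rw [← h, freeφ, DMF.eval_neg]
  cases (orFin fun v => (DMF.var (St.mt v w) : DMF (St m))).eval y <;> simp

/-- `freeφ w` is true iff `w` is unmatched. [folklore] -/
theorem freeφ_eval (w : Fin m) : (freeφ w).eval y = true ↔ ∀ v, y (.mt v w) = false := by
  have h := freeφ_eval_false y w
  cases hf : (freeφ w).eval y
  · rw [hf] at h; simp only [true_iff] at h; obtain ⟨v, hv⟩ := h
    simp only [Bool.false_eq_true, false_iff, not_forall]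
    exact ⟨v, by simp [hv]⟩
  · rw [hf] at h; simp only [Bool.true_eq_false, false_iff, not_exists] at h
    simp only [true_iff]
    intro v; simpa using h v

/-- The selection layer on the `wsel` coordinates: the least reached unmatched right vertex. [folklore] -/
theorem chooseSt_wsel (w : Fin m) :
    chooseSt y (.wsel w) = true ↔ y (.t w) = true ∧ (∀ v, y (.mt v w) = false) ∧
      ∀ w', w' < w → (y (.t w') = false ∨ ∃ v, y (.mt v w') = true) := by
  simp [chooseSt, chooseφ, eval_andLt, freeφ_eval, freeφ_eval_false]

/-- The selection layer on the `ok` coordinate: some reached right vertex is unmatched. [folklore] -/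
theorem chooseSt_ok :
    chooseSt y .ok = true ↔ ∃ w, y (.t w) = true ∧ ∀ v, y (.mt v w) = false := by
  simp [chooseSt, chooseφ, eval_orFin, freeφ_eval]

/-- The selection layer passes the `x` coordinates through. [folklore] -/
@[simp] theorem chooseSt_x (v w : Fin m) : chooseSt y (.x v w) = y (.x v w) := rfl
/-- The selection layer passes the `mt` coordinates through. [folklore] -/
@[simp] theorem chooseSt_mt (v w : Fin m) : chooseSt y (.mt v w) = y (.mt v w) := rfl
/-- The selection layer passes the `s` coordinates through. [folklore] -/
@[simp] theorem chooseSt_s (v : Fin m) : chooseSt y (.s v) = y (.s v) := rfl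
/-- The selection layer passes the `t` coordinates through. [folklore] -/
@[simp] theorem chooseSt_t (w : Fin m) : chooseSt y (.t w) = y (.t w) := rfl
/-- The selection layer passes the `p` coordinates through. [folklore] -/
@[simp] theorem chooseSt_p (v w : Fin m) : chooseSt y (.p v w) = y (.p v w) := rfl
/-- The selection layer clears the `pl` coordinates. [folklore] -/
@[simp] theorem chooseSt_pl (v : Fin m) : chooseSt y (.pl v) = false := by simp [chooseSt, chooseφ]
/-- The selection layer clears the `pr` coordinates. [folklore] -/
@[simp] theorem chooseSt_pr (w : Fin m) : chooseSt y (.pr w) = false := by simp [chooseSt, chooseφ]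

/-- Semantics of `prφ`. [folklore] -/
theorem prφ_eval (w : Fin m) : (prφ w).eval y = true ↔
    y (.pr w) = true ∨ y (.wsel w) = true ∨ ∃ v, y (.pl v) = true ∧ y (.mt v w) = true := by
  simp [prφ, eval_orFin, or_assoc]

/-- The path layer on the `pr` coordinates. [folklore] -/
theorem pathSt_pr (w : Fin m) : pathSt y (.pr w) = true ↔
    y (.pr w) = true ∨ y (.wsel w) = true ∨ ∃ v, y (.pl v) = true ∧ y (.mt v w) = true := by
  simp [pathSt, pathφ, prφ_eval]

/-- The path layer on the `pl` coordinates. [folklore] -/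
theorem pathSt_pl (v : Fin m) : pathSt y (.pl v) = true ↔
    y (.pl v) = true ∨ ∃ w, pathSt y (.pr w) = true ∧ y (.p v w) = true := by
  simp [pathSt, pathφ, eval_orFin, prφ_eval]

/-- The path layer passes the `x` coordinates through. [folklore] -/
@[simp] theorem pathSt_x (v w : Fin m) : pathSt y (.x v w) = y (.x v w) := rfl
/-- The path layer passes the `mt` coordinates through. [folklore] -/
@[simp] theorem pathSt_mt (v w : Fin m) : pathSt y (.mt v w) = y (.mt v w) := rfl
/-- The path layer passes the `s` coordinates through. [folklore] -/
@[simp] theorem pathSt_s (v : Fin m) : pathSt y (.s v) = y (.s v) := rfl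
/-- The path layer passes the `t` coordinates through. [folklore] -/
@[simp] theorem pathSt_t (w : Fin m) : pathSt y (.t w) = y (.t w) := rfl
/-- The path layer passes the `p` coordinates through. [folklore] -/
@[simp] theorem pathSt_p (v w : Fin m) : pathSt y (.p v w) = y (.p v w) := rfl
/-- The path layer passes the `wsel` coordinates through. [folklore] -/
@[simp] theorem pathSt_wsel (w : Fin m) : pathSt y (.wsel w) = y (.wsel w) := rfl
/-- The path layer passes the `ok` coordinates through. [folklore] -/
@[simp] theorem pathSt_ok : pathSt y .ok = y .ok := rfl

/-- The augmentation layer on the matching coordinates. [folklore] -/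
theorem augmentSt_mt (v w : Fin m) : augmentSt y (.mt v w) = true ↔
    (y .ok = true ∧ ((y (.pr w) = true ∧ y (.p v w) = true) ∨
      (y (.mt v w) = true ∧ y (.pl v) = false ∧ y (.pr w) = false))) ∨
    (y .ok = false ∧ y (.mt v w) = true) := by
  simp [augmentSt, augmentφ]

/-- The augmentation layer passes the `x` coordinates through. [folklore] -/
@[simp] theorem augmentSt_x (v w : Fin m) : augmentSt y (.x v w) = y (.x v w) := rfl
/-- The augmentation layer passes the `s` coordinates through. [folklore] -/
@[simp] theorem augmentSt_s (v : Fin m) : augmentSt y (.s v) = y (.s v) := rfl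
/-- The augmentation layer passes the `t` coordinates through. [folklore] -/
@[simp] theorem augmentSt_t (w : Fin m) : augmentSt y (.t w) = y (.t w) := rfl
/-- The augmentation layer passes the `p` coordinates through. [folklore] -/
@[simp] theorem augmentSt_p (v w : Fin m) : augmentSt y (.p v w) = y (.p v w) := rfl
/-- The augmentation layer passes the `wsel` coordinates through. [folklore] -/
@[simp] theorem augmentSt_wsel (w : Fin m) : augmentSt y (.wsel w) = y (.wsel w) := rfl
/-- The augmentation layer passes the `ok` coordinates through. [folklore] -/
@[simp] theorem augmentSt_ok : augmentSt y .ok = y .ok := rfl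
/-- The augmentation layer passes the `pl` coordinates through. [folklore] -/
@[simp] theorem augmentSt_pl (v : Fin m) : augmentSt y (.pl v) = y (.pl v) := rfl
/-- The augmentation layer passes the `pr` coordinates through. [folklore] -/
@[simp] theorem augmentSt_pr (w : Fin m) : augmentSt y (.pr w) = y (.pr w) := rfl

/-- The input layer loads the edges. [folklore] -/
@[simp] theorem initSt_x (x : Fin m × Fin m → Bool) (v w : Fin m) :
    initSt x (.x v w) = x (v, w) := rfl
/-- The input layer starts from the empty matching. [folklore] -/
@[simp] theorem initSt_mt (x : Fin m × Fin m → Bool) (v w : Fin m) :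
    initSt x (.mt v w) = false := rfl

/-- The output bit says that every left vertex is matched. [folklore] -/
theorem outSt_eq (u : Unit) : outSt y u = decide (∀ v, ∃ w, y (.mt v w) = true) := rfl

end eval

/-! ### Frame properties of the iterated layers -/

/-- Iterated BFS layers pass the `x` coordinates through. [folklore] -/
theorem bfsSt_iterate_x (n : ℕ) (y : St m → Bool) (v w : Fin m) :
    (bfsSt^[n] y) (.x v w) = y (.x v w) := by
  induction n generalizing y with
  | zero => rfl
  | succ n ih => rw [Function.iterate_succ_apply, ih, bfsSt_x]

/-- Iterated BFS layers pass the `mt` coordinates through. [folklore] -/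
theorem bfsSt_iterate_mt (n : ℕ) (y : St m → Bool) (v w : Fin m) :
    (bfsSt^[n] y) (.mt v w) = y (.mt v w) := by
  induction n generalizing y with
  | zero => rfl
  | succ n ih => rw [Function.iterate_succ_apply, ih, bfsSt_mt]

/-- Iterated path layers pass the `x` coordinates through. [folklore] -/
theorem pathSt_iterate_x (n : ℕ) (y : St m → Bool) (v w : Fin m) :
    (pathSt^[n] y) (.x v w) = y (.x v w) := by
  induction n generalizing y with
  | zero => rfl
  | succ n ih => rw [Function.iterate_succ_apply, ih, pathSt_x]

/-- Iterated path layers pass the `mt` coordinates through. [folklore] -/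
theorem pathSt_iterate_mt (n : ℕ) (y : St m → Bool) (v w : Fin m) :
    (pathSt^[n] y) (.mt v w) = y (.mt v w) := by
  induction n generalizing y with
  | zero => rfl
  | succ n ih => rw [Function.iterate_succ_apply, ih, pathSt_mt]

/-- Iterated path layers pass the `s` coordinates through. [folklore] -/
theorem pathSt_iterate_s (n : ℕ) (y : St m → Bool) (v : Fin m) :
    (pathSt^[n] y) (.s v) = y (.s v) := by
  induction n generalizing y with
  | zero => rfl
  | succ n ih => rw [Function.iterate_succ_apply, ih, pathSt_s]

/-- Iterated path layers pass the `t` coordinates through. [folklore] -/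
theorem pathSt_iterate_t (n : ℕ) (y : St m → Bool) (w : Fin m) :
    (pathSt^[n] y) (.t w) = y (.t w) := by
  induction n generalizing y with
  | zero => rfl
  | succ n ih => rw [Function.iterate_succ_apply, ih, pathSt_t]

/-- Iterated path layers pass the `p` coordinates through. [folklore] -/
theorem pathSt_iterate_p (n : ℕ) (y : St m → Bool) (v w : Fin m) :
    (pathSt^[n] y) (.p v w) = y (.p v w) := by
  induction n generalizing y with
  | zero => rfl
  | succ n ih => rw [Function.iterate_succ_apply, ih, pathSt_p]

/-- Iterated path layers pass the `wsel` coordinates through. [folklore] -/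
theorem pathSt_iterate_wsel (n : ℕ) (y : St m → Bool) (w : Fin m) :
    (pathSt^[n] y) (.wsel w) = y (.wsel w) := by
  induction n generalizing y with
  | zero => rfl
  | succ n ih => rw [Function.iterate_succ_apply, ih, pathSt_wsel]

/-- Iterated path layers pass the `ok` coordinates through. [folklore] -/
theorem pathSt_iterate_ok (n : ℕ) (y : St m → Bool) : (pathSt^[n] y) .ok = y .ok := by
  induction n generalizing y with
  | zero => rfl
  | succ n ih => rw [Function.iterate_succ_apply, ih, pathSt_ok]

/-- A phase does not change the edge coordinates. [folklore] -/
theorem phaseSt_x (u : Fin m) (y : St m → Bool) (v w : Fin m) :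
    phaseSt u y (.x v w) = y (.x v w) := by
  simp [phaseSt, pathSt_iterate_x, bfsSt_iterate_x]

/-- The phases do not change the edge coordinates. [folklore] -/
theorem phasesSt_x (k : ℕ) (y : St m → Bool) (v w : Fin m) :
    phasesSt k y (.x v w) = y (.x v w) := by
  induction k with
  | zero => rfl
  | succ k ih =>
    simp only [phasesSt]
    split_ifs
    · rw [phaseSt_x, ih]
    · exact ih

/-! ### Size of the formulas and of the whole circuit -/

/-- A uniform bound for the size of every formula of every layer. [folklore] -/
def fBound (m : ℕ) : ℕ := 10 * (m + 1) ^ 2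

/-- Size of `tφ`. [folklore] -/
theorem size_tφ (w : Fin m) : (tφ w).size ≤ 2 * m + 3 := by
  have := size_orFin_le (fun v => DMF.conj (DMF.var (.s v)) (DMF.var (St.x v w))) (c := 1)
    (fun _ => by simp)
  simp only [tφ, DMF.size_disj, DMF.size_var]
  omega

/-- Size of `freeφ`. [folklore] -/
theorem size_freeφ (w : Fin m) : (freeφ w).size ≤ 2 * m + 3 := by
  have := size_orFin_le (fun v => (DMF.var (St.mt v w) : DMF (St m))) (c := 0) (fun _ => by simp)
  simp only [freeφ, DMF.size_neg]
  omega

/-- Size of `prφ`. [folklore] -/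
theorem size_prφ (w : Fin m) : (prφ w).size ≤ 2 * m + 4 := by
  have := size_orFin_le (fun v => DMF.conj (DMF.var (.pl v)) (DMF.var (St.mt v w))) (c := 1)
    (fun _ => by simp)
  simp only [prφ, DMF.size_disj, DMF.size_var]
  omega

/-- `fBound m` dominates the quadratic polynomials arising as formula sizes. [folklore] -/
theorem fBound_ge (m : ℕ) : 2 * m * m + 8 * m + 10 ≤ fBound m := by
  simp only [fBound]; nlinarith

/-- Every BFS formula has size `≤ fBound m`. [folklore] -/
theorem size_bfsφ (k : St m) : (bfsφ k).size ≤ fBound m := by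
  have hB := fBound_ge m
  cases k with
  | t w => exact (size_tφ w).trans (by nlinarith)
  | p v w =>
    have := size_andLt_le v (fun v' => DMF.neg (DMF.conj (DMF.var (.s v')) (DMF.var (St.x v' w))))
      (c := 2) (fun _ => by simp)
    simp only [bfsφ, DMF.size_disj, DMF.size_conj, DMF.size_neg, DMF.size_var]
    nlinarith
  | s v =>
    have := size_orFin_le (fun w => DMF.conj (tφ w) (DMF.var (St.mt v w))) (c := 2 * m + 4)
      (fun w => by have := size_tφ (m := m) w; simp only [DMF.size_conj, DMF.size_var]; omega)
    simp only [bfsφ, DMF.size_disj, DMF.size_var]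
    nlinarith
  | _ => simp [bfsφ, fBound]

/-- `2 ≤ fBound m`. [folklore] -/
theorem two_le_fBound (m : ℕ) : 2 ≤ fBound m := by have := fBound_ge m; omega

/-- Every reset formula has size `≤ fBound m`. [folklore] -/
theorem size_resetφ (u : Fin m) (k : St m) : (resetφ u k).size ≤ fBound m := by
  have h2 := two_le_fBound m
  cases k with
  | s v =>
    simp only [resetφ]
    split <;> simpa [ttm, ffm] using h2
  | x v w => simp [resetφ]
  | mt v w => simp [resetφ]
  | _ => simpa [resetφ, ffm] using h2

/-- Every selection formula has size `≤ fBound m`. [folklore] -/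
theorem size_chooseφ (k : St m) : (chooseφ k).size ≤ fBound m := by
  have hB := fBound_ge m
  cases k with
  | wsel w =>
    have h1 := size_freeφ (m := m) w
    have := size_andLt_le w (fun w' => DMF.neg (DMF.conj (DMF.var (St.t w')) (freeφ w')))
      (c := 2 * m + 5)
      (fun w' => by have := size_freeφ (m := m) w'; simp only [DMF.size_neg, DMF.size_conj,
        DMF.size_var]; omega)
    simp only [chooseφ, DMF.size_conj, DMF.size_var]
    nlinarith
  | ok =>
    have := size_orFin_le (fun w => DMF.conj (DMF.var (St.t w)) (freeφ w)) (c := 2 * m + 4)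
      (fun w => by have := size_freeφ (m := m) w; simp only [DMF.size_conj, DMF.size_var]; omega)
    simp only [chooseφ]
    nlinarith
  | pl v => simp [chooseφ, ffm]; omega
  | pr v => simp [chooseφ, ffm]; omega
  | _ => simp [chooseφ, fBound]

/-- Every path formula has size `≤ fBound m`. [folklore] -/
theorem size_pathφ (k : St m) : (pathφ k).size ≤ fBound m := by
  have hB := fBound_ge m
  cases k with
  | pr w => exact (size_prφ w).trans (by nlinarith)
  | pl v =>
    have := size_orFin_le (fun w => DMF.conj (prφ w) (DMF.var (St.p v w))) (c := 2 * m + 5)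
      (fun w => by have := size_prφ (m := m) w; simp only [DMF.size_conj, DMF.size_var]; omega)
    simp only [pathφ, DMF.size_disj, DMF.size_var]
    nlinarith
  | _ => simp [pathφ, fBound]

/-- Every augmentation formula has size `≤ fBound m`. [folklore] -/
theorem size_augmentφ (k : St m) : (augmentφ k).size ≤ fBound m := by
  have hB := fBound_ge m
  cases k with
  | mt v w => simp [augmentφ]; omega
  | _ => simp [augmentφ]

/-- The size of one layer: `card (St m) * fBound m ≤ 90 (m+1)^4`. [folklore] -/
def layerBound (m : ℕ) : ℕ := 90 * (m + 1) ^ 4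

/-- `card (St m) * fBound m ≤ layerBound m`. [folklore] -/
theorem card_mul_fBound_le : Fintype.card (St m) * fBound m ≤ layerBound m := by
  have := card_St_le (m := m)
  calc Fintype.card (St m) * fBound m ≤ 9 * (m + 1) ^ 2 * fBound m := Nat.mul_le_mul_right _ this
    _ = layerBound m := by simp only [fBound, layerBound]; ring

/-- A layer given by formulas of size `≤ fBound m` costs at most `layerBound m` gates. [folklore] -/
theorem cktSize_layer (φ : St m → DMF (St m)) (h : ∀ k, (φ k).size ≤ fBound m) :
    CktSize deMorganBasis (fun (y : St m → Bool) k => (φ k).eval y) (layerBound m) :=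
  (cktSize_formulaLayer φ h).of_le card_mul_fBound_le

/-- Size of the BFS layer. [folklore] -/
theorem cktSize_bfsSt : CktSize deMorganBasis (bfsSt (m := m)) (layerBound m) :=
  cktSize_layer bfsφ size_bfsφ

/-- Size of the reset layer. [folklore] -/
theorem cktSize_resetSt (u : Fin m) : CktSize deMorganBasis (resetSt u) (layerBound m) :=
  cktSize_layer (resetφ u) (size_resetφ u)

/-- Size of the selection layer. [folklore] -/
theorem cktSize_chooseSt : CktSize deMorganBasis (chooseSt (m := m)) (layerBound m) :=
  cktSize_layer chooseφ size_chooseφ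

/-- Size of the path layer. [folklore] -/
theorem cktSize_pathSt : CktSize deMorganBasis (pathSt (m := m)) (layerBound m) :=
  cktSize_layer pathφ size_pathφ

/-- Size of the augmentation layer. [folklore] -/
theorem cktSize_augmentSt : CktSize deMorganBasis (augmentSt (m := m)) (layerBound m) :=
  cktSize_layer augmentφ size_augmentφ

/-- Size of one phase. [folklore] -/
def phaseBound (m : ℕ) : ℕ := (4 * m + 3) * layerBound m

/-- Size of one phase: `(4m + 3) · layerBound m`. [folklore] -/
theorem cktSize_phaseSt (u : Fin m) : CktSize deMorganBasis (phaseSt u) (phaseBound m) := by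
  have h := ((((cktSize_resetSt u).comp (cktSize_bfsSt.iterate (2 * m))).comp
    cktSize_chooseSt).comp (cktSize_pathSt.iterate (2 * m))).comp cktSize_augmentSt
  refine (h.of_le ?_).congr fun y k => rfl
  simp only [phaseBound]; ring_nf; omega

/-- Size of `k` phases. [folklore] -/
theorem cktSize_phasesSt (k : ℕ) : CktSize deMorganBasis (phasesSt (m := m) k) (k * phaseBound m) := by
  induction k with
  | zero =>
    rw [Nat.zero_mul]
    exact (CktSize.id (ι := St m) deMorganBasis).congr fun _ _ => rfl
  | succ k ih =>
    by_cases hk : k < m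
    · have h := ih.comp (cktSize_phaseSt ⟨k, hk⟩)
      rw [Nat.succ_mul]
      exact h.congr fun y j => by simp [phasesSt, hk]
    · rw [Nat.succ_mul]
      exact (ih.of_le (Nat.le_add_right _ _)).congr fun y j => by simp [phasesSt, hk]

open DMF in
/-- The input layer as formulas over the input variables (a variable `e₀` is needed for the
constant `false`). [folklore] -/
def initφ (e₀ : Fin m × Fin m) : St m → DMF (Fin m × Fin m)
  | .x v w => var (v, w)
  | _ => DMF.ff e₀

/-- Size of the input layer. [folklore] -/
theorem cktSize_initSt (e₀ : Fin m × Fin m) :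
    CktSize deMorganBasis (initSt (m := m)) (layerBound m) := by
  have h2 := two_le_fBound m
  have h := cktSize_formulaLayer (initφ e₀) (c := fBound m)
    (fun k => by cases k <;> simp [initφ, h2])
  exact (h.of_le card_mul_fBound_le).congr fun x k => by cases k <;> simp [initφ, initSt]

open DMF in
/-- The output formula `⋀_v ⋁_w M v w`. [folklore] -/
def outφ : DMF (St m) := andFin fun v => orFin fun w => var (.mt v w)

/-- Size of the output layer. [folklore] -/
theorem cktSize_outSt : CktSize deMorganBasis (outSt (m := m)) (layerBound m) := by
  have hs : (outφ (m := m)).size ≤ fBound m := by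
    have := size_andFin_le (fun v => orFin fun w => (DMF.var (St.mt v w) : DMF (St m)))
      (c := m + 2) (fun v => by
        have := size_orFin_le (fun w => (DMF.var (St.mt v w) : DMF (St m))) (c := 0)
          (fun _ => by simp)
        omega)
    have hB := fBound_ge m
    simp only [outφ]
    nlinarith
  have h := (DMF.cktSize (outφ (m := m))).of_le hs
  refine (h.of_le ?_).congr fun y u => ?_
  · have : 1 ≤ Fintype.card (St m) := Fintype.card_pos_iff.mpr ⟨.ok⟩
    calc fBound m = 1 * fBound m := (one_mul _).symm
      _ ≤ Fintype.card (St m) * fBound m := Nat.mul_le_mul_right _ this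
      _ ≤ layerBound m := card_mul_fBound_le
  · rw [outSt_eq]
    apply Bool.eq_iff_iff.mpr
    simp [outφ, eval_andFin, eval_orFin]

/-- Total size of the matching circuit. [folklore] -/
def totalBound (m : ℕ) : ℕ := layerBound m + m * phaseBound m + layerBound m

/-- **The matching circuit has polynomial size**: `pmFn` is computed by a `{∧₂, ∨₂, ¬}`-program with at most `totalBound m` gates (given any input variable `e₀`, used for the constants). [folklore] -/
theorem cktSize_pmFn (e₀ : Fin m × Fin m) :
    CktSize deMorganBasis (pmFn (m := m)) (totalBound m) :=
  (((cktSize_initSt e₀).comp (cktSize_phasesSt m)).comp cktSize_outSt).congr fun _ _ => rfl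

/-- `totalBound m ≤ 600 (m + 1) ^ 6`. [folklore] -/
theorem totalBound_le (m : ℕ) : totalBound m ≤ 600 * (m + 1) ^ 6 := by
  have h1 : m * (4 * m + 3) + 2 ≤ 6 * (m + 1) ^ 2 := by nlinarith
  calc totalBound m = (m * (4 * m + 3) + 2) * (90 * (m + 1) ^ 4) := by
        simp only [totalBound, phaseBound, layerBound]; ring
    _ ≤ 6 * (m + 1) ^ 2 * (90 * (m + 1) ^ 4) := Nat.mul_le_mul_right _ h1
    _ = 540 * (m + 1) ^ 6 := by ring
    _ ≤ 600 * (m + 1) ^ 6 := by omega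

end BipMatch

end Literature.Computability.Complexity
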